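/-
Copyright: statement-level skeleton of a published paper (lit-balaban cell, Phase-2 proof seat p39 gen 7). No proof claims
beyond what the kernel checks below.
-/
import Literature.MathematicalPhysics.QuantumFieldTheory.Balaban1983to89.B3Eq323CrossTermsZeroTorus
import Literature.MathematicalPhysics.QuantumFieldTheory.Balaban1983to89.B3KernelBlockSmearing

/-!
# B3 — T. Bałaban, *(Higgs)₂,₃ quantum fields in a finite volume. III. Renormalization*, CMP **88** (1983) 411–445
[Balaban1983Higgs3], p. 441 [PDF 31] with p. 437 [PDF 27]: the KERNEL BOUNDS *"and the corresponding inequalities for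
derivatives"* for the ZERO-FIELD TORUS INSTANCE that the p. 441 sentence *"If at least one propagator G_{j₀}(0) is replaced by
G_{j₀}(0)(1 − m²_{j₀} − a_{j₀}P_{j₀})C^ξ, then we get a convergent expression"* needs beyond those of this seat's gen 6: the
COLUMN differences `(G∂^{ξ*}_μ)(y,x′)`, `(C^ξ∂^{ξ*}_μ)(y,x′)` and the MIXED second differences `(∂^ξ_{μ′}G∂^{ξ*}_μ)(x,x′)` of the
rescaled torus propagator `G^ξ_k(0)` (`G0xi`) — the kernels of the vector self-energy (3.26) — and the action of the middle
operator `D = (1 − (L^kε)²m²)·1 − a_kP_k` of (3.16) on such kernels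

statement-level skeleton of published theorems with citation tags; proofs where landed; nothing here is a claim about
the Yang–Mills mass gap

PDF held: `paper:balaban1983-higgs-2-3-quantum-fields-finite-volume` (journal page = PDF page + 410); pp. 437, 441 read on the
×2 renders `run/shared/lean/pub/pub-balaban/b2b-balaban-ref1/pages/1983-cmp88-higgs23-III/1983-cmp88-higgs23-III-p027-x2.png`,
`…-p031-x2.png`.  Row **B3.Eq3.25-3.32** of `HOME/lit-balaban-r15/ROWS-B3.md` (fold owner r15).  Inputs used BY NAME: p20 g5's
`B3Sect3KernelsZeroTorus.gpiece_bounds` (all four (2.10)-type piece bounds incl. the column and mixed differences, rate in the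
`ℓ¹` distance) and `pieceT_symm`; this seat's gen 6 `B3GkZeroTorusRescaled` (`G0xi`, `G0xi_eq_sum_gpiece`, `scaleSum_le_max`,
`piece_exp_le`, `G0xi_bounds`), `B3Eq316ResolventZeroTorus` (`Dmid`, `Dmid_apply`, `Pk_abs_le`, `eta_supDist_le_two_of_Pk_ne_zero`),
`B3Eq323CrossTermsZeroTorus` (`sum_abs_Pk_row`, `abs_CxiT_profile`), `B3Bound316ZeroTorus.abs_d1Kernel_CxiT_profile`,
p03's `B3CxiTorusBound.CxiT_symm`; this seat's gen 7 `B3KernelBlockSmearing` (`smear_one_le`, `smear_two_le`).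
* §1 **`G0xi_symm`** (the rescaled propagator is a symmetric kernel); `dAdjKernel_eq_d1Kernel_of_symm` (for a symmetric kernel
  the column difference `(G∂^{ξ*}_μ)(y,x′)` is the row difference `(∂^ξ_μG)(x′,y)`); `d2Kernel_finset_sum`, **`d2Kernel_G0xi_eq`**
  (`(∂^ξ_{μ′}G^ξ_k(0)∂^{ξ*}_μ) = (L^kε)^d·Σ_{j<k}(∂^η_{μ′}G^η_{(j)}∂^{η*}_μ)`); **`G0xi_mixed_bound`**: `∃ δ C > 0` uniform in the
  volume `P = (3,L,m,K)` and in `1 ≤ k ≤ K` with `|(∂^ξ_{μ′}G^ξ_k(0)∂^{ξ*}_μ)(x,x′)| ≤ C(ξ·max(1,|x−x′|))^{−3}e^{−δξ|x−x′|}` at ALL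
  sites, all `μ′, μ` — p. 437 *"the corresponding inequalities for derivatives"* for the second-order kernel of (3.26), from the
  piece bounds (2.10) summed over the scales (`scaleSum_le_max`, `p = 3`).
* §2 `dAdjKernel_CxiT_profile`: `|(C^ξ_T∂^{ξ*}_μ)(y,x′)| ≤ (3037500 + torusConst + 472501)(ξ·max(1,|y−x′|))^{−2}e^{−½ξ|y−x′|}`.
* §3 **`abs_Dmid_smear_one_le`**, **`abs_Dmid_smear_two_le`**: for a kernel `K` with a 1- resp. 2-profile (constant `b`, rate
  `β`), `|Σ_{z′}D(z,z′)K(z′,y)| ≤ ((1 + m²) + a·S_p(β))·b·(profile at (z,y))`, `S₁(β) = 4e^{4β}(1 + R′_β) + 2e^{2β}`,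
  `S₂(β) = 16e^{4β}(1 + R_β) + 4e^{2β}` (`R_β = radialConst 3 β 1 0`, `R′_β = radialConst 3 β 1 1`) — the middle operator of
  (3.16) preserves the p. 437 kernel shapes (`|1 − (L^kε)²m²| ≤ 1 + m²`, `0 ≤ a_k ≤ a`, `|P_k| ≤ ξ^d` on unit blocks with row
  sums `1`).
HONEST SCOPE: the model instance `A = B̃ = 0`, `U ≡ 1`, `Ω` = the whole torus; `d = 3` in the bounds; constants existential in
§1 (functions of `L, a, m²`), explicit elsewhere; the sup torus distance.  Mathlib + the cited tree files only; theorems only,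
no definitions, no named facts; standard axioms.  Unit `lit-balaban-p39-g7` (Phase-2 proof seat p39, gen 7), HOME
`run/shared/lean/pub/lit-balaban/`, 2026-08-21.
-/

open scoped BigOperators

namespace Literature.MathematicalPhysics.QuantumFieldTheory.Balaban1983to89.B3ZeroTorusKernelProfiles

open Matrix Finset B1RG242Torus B3GkZeroTorusRescaled B3Eq316ResolventZeroTorus B3KernelConvolutionTorus
open B3KernelConvolutionTorusSup B3Bound316ZeroTorus B3Eq323CrossTermsZeroTorus B3KernelBlockSmearing
open LatticeFieldCalculus B3Sect3ScalarSelfEnergy B3TorusRadialSums B3Bound316 B3CxiTorusBound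
open B3Sect3KernelsZeroTorus (gpiece gpiece_bounds pieceT_symm)
open B3Sect3VectorSelfEnergy (dAdjKernel d2Kernel)

noncomputable section

variable {P : Params}

/-! ## §1 The rescaled propagator: symmetry, column differences, mixed second differences -/

section G0

/-- **`G^ξ_k(0)` is a symmetric kernel**: `G^ξ_k(0)(y,y′) = G^ξ_k(0)(y′,y)` (sum (2.6) of the symmetric pieces, `pieceT_symm`).
[cite: Balaban1983Higgs3, (2.6) p.424, (3.16) p.437] -/
theorem G0xi_symm {a msq : ℝ} (ha : 0 < a) (hm : 0 ≤ msq) (hd : 2 ≤ P.d) {k : ℕ} (hk : 1 ≤ k) (hkm : k ≤ P.m + P.K)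
    (y y' : Site P 0) : G0xi P a msq k y y' = G0xi P a msq k y' y := by
  rw [G0xi_eq_sum_gpiece ha hm hd hk, G0xi_eq_sum_gpiece ha hm hd hk]
  congr 1
  refine Finset.sum_congr rfl fun j _ => ?_
  unfold gpiece
  rw [pieceT_symm ha hm hkm j y y']

/-- For a SYMMETRIC kernel the column difference `(G∂^{ξ*}_μ)(y,x′) = c(G(y,x′+e_μ) − G(y,x′))` is the row difference
`(∂^ξ_μG)(x′,y)` at the swapped arguments. [cite: Balaban1983Higgs3, (3.26) p.440] -/
theorem dAdjKernel_eq_d1Kernel_of_symm {j : ℕ} (c : ℝ) (μ : Fin P.d) (G : Kernel P j)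
    (hG : ∀ y y' : Site P j, G y y' = G y' y) (y x' : Site P j) :
    dAdjKernel c μ G y x' = d1Kernel c μ G x' y := by
  unfold dAdjKernel d1Kernel
  rw [hG y (x'.shift μ), hG y x']

/-- kernel: the mixed second difference of a finite sum of kernels is the sum of the mixed second differences. [folklore] -/
private theorem d2Kernel_finset_sum {j : ℕ} {ι : Type*} (s : Finset ι) (c : ℝ) (μ' μ : Fin P.d)
    (f : ι → Kernel P j) (x x' : Site P j) :
    d2Kernel c μ' μ (fun y y' => ∑ i ∈ s, f i y y') x x' = ∑ i ∈ s, d2Kernel c μ' μ (f i) x x' := by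
  simp only [d2Kernel, Finset.mul_sum, mul_sub, mul_add, Finset.sum_add_distrib, Finset.sum_sub_distrib]

/-- **`(∂^ξ_{μ′}G^ξ_k(0)∂^{ξ*}_μ)(x,x′) = (L^kε)^d·Σ_{j<k}(∂^η_{μ′}G^η_{(j)}∂^{η*}_μ)(x,x′)`**: the mixed second difference of the rescaled
kernel is the rescaled sum of those of the pieces (`∂^ξ = (L^kε)∂^η`, `G^ξ_k(0) = (L^kε)^{d−2}Σ_{j<k}G^η_{(j)}`).
[cite: Balaban1983Higgs3, (3.16) p.437, (3.26) p.441] -/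
theorem d2Kernel_G0xi_eq {a msq : ℝ} (ha : 0 < a) (hm : 0 ≤ msq) (hd : 2 ≤ P.d) {k : ℕ} (hk : 1 ≤ k) (μ' μ : Fin P.d)
    (x x' : Site P 0) :
    d2Kernel (P.eta k)⁻¹ μ' μ (G0xi P a msq k) x x' =
      P.spacing k ^ P.d * ∑ j ∈ range k, d2Kernel P.eps⁻¹ μ' μ (gpiece P a msq k j) x x' := by
  have hG : G0xi P a msq k = fun y y' => P.spacing k ^ (P.d - 2) * (fun y y' => ∑ j ∈ range k, gpiece P a msq k j y y') y y' := by
    funext y y'; exact G0xi_eq_sum_gpiece ha hm hd hk y y'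
  have hη : (P.eta k)⁻¹ = ((P.spacing k)⁻¹ * P.eps)⁻¹ := by
    rw [mul_inv, inv_inv, eta_inv_eq]
  rw [hG, hη, B3Sect3VectorSelfEnergy.d2Kernel_rescale, inv_inv]
  beta_reduce
  rw [d2Kernel_finset_sum]
  have hsplit : P.spacing k ^ P.d = P.spacing k ^ (P.d - 2) * P.spacing k ^ 2 := by
    rw [← pow_add]; congr 1; omega
  rw [hsplit]

/-- kernel: the rpow `s^{−d}` at `d = 3` as an inverse cube. [folklore] -/
private theorem rpow_neg_three {s : ℝ} (hs : 0 < s) : s ^ (-((3 : ℕ) : ℝ)) = (s ^ 3)⁻¹ := by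
  rw [Real.rpow_neg hs.le, Real.rpow_natCast]

/-- **p. 437 "the corresponding inequalities for derivatives" for the SECOND-ORDER kernel `(∂^ξ_{μ′}G^ξ_k(0)∂^{ξ*}_μ)` of (3.26), at the
zero-field torus instance, ALL SITES** (`d = 3`).  For odd `L > 1`, `a > 0`, `m² ≥ 0` there are `δ, C > 0` (functions of `L, a, m²`)
such that for EVERY volume `P = (3, L, m, K)`, every scale `1 ≤ k ≤ K` (`ξ = L^{−k}`), all `μ′, μ, x, x′`:
`|(∂^ξ_{μ′}G^ξ_k(0)∂^{ξ*}_μ)(x,x′)| ≤ C(ξ·max(1,|x−x′|))^{−3}e^{−δξ|x−x′|}` (the diagonal included, there `ξ^{−3}`).  Route: (2.6) + the mixed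
piece bounds (2.10) (`gpiece_bounds`, fourth clause) summed over the scales (`scaleSum_le_max`, `p = 3`).
[cite: Balaban1983Higgs3, (3.16) p.437, (2.10) p.426] -/
theorem G0xi_mixed_bound (L : ℕ) (hL : Odd L ∧ 1 < L) {a : ℝ} (ha : 0 < a) {msq : ℝ} (hmsq : 0 ≤ msq) :
    ∃ δ C : ℝ, 0 < δ ∧ 0 < C ∧ ∀ (P : Params), P.d = 3 → P.L = L → ∀ k : ℕ, 1 ≤ k → k ≤ P.K →
      ∀ (μ' μ : Fin P.d) (x x' : Site P 0), |d2Kernel (P.eta k)⁻¹ μ' μ (G0xi P a msq k) x x'| ≤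
        C * (((P.eta k * max (1 : ℝ) (supDist x x' : ℝ)) ^ 3)⁻¹ * Real.exp (-(δ * (P.eta k * (supDist x x' : ℝ))))) := by
  obtain ⟨δ₀, C₀, hδ₀, hC₀, HB⟩ := gpiece_bounds 3 L (by norm_num) hL ha hmsq
  have hL1 : (1 : ℝ) < (L : ℝ) := by exact_mod_cast hL.2
  have hL0 : (0 : ℝ) < (L : ℝ) := by linarith
  set Cs3 : ℝ := (L : ℝ) / ((L : ℝ) - 1) * Real.exp (δ₀ / 2) +
      ((3 : ℕ).factorial : ℝ) / (δ₀ / 2) ^ 3 * (1 - Real.exp (-(δ₀ / 2 * ((L : ℝ) - 1))))⁻¹ + (1 - ((L : ℝ) ^ 3)⁻¹)⁻¹ with hCs3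
  have hCs3' : 0 ≤ Cs3 := add_nonneg (scaleConst_nonneg hL1 hδ₀ 3) (zeroConst_nonneg hL1 (by norm_num))
  refine ⟨δ₀ / 2, C₀ * (Cs3 + 1), half_pos hδ₀, mul_pos hC₀ (by linarith), fun P hPd hPL k hk1 hkK μ' μ x x' => ?_⟩
  obtain ⟨-, -, -, hmix⟩ := HB P hPd hPL k hk1 hkK
  have hd2 : 2 ≤ P.d := by omega
  have hε : 0 < P.eps := P.eps_pos
  have hs : 0 < P.spacing k := P.spacing_pos k
  have hηL : P.eta k = ((P.L : ℝ) ^ k)⁻¹ := eta_eq_inv_pow P k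
  have hPL' : ((P.L : ℝ)) = (L : ℝ) := by rw [hPL]
  have hsj : ∀ j, P.spacing j = (P.L : ℝ) ^ j * P.eps := fun j => rfl
  -- the mixed piece bound in the `(L^j)^{−3}` form with decay in `supDist`
  have hmix' : ∀ (j : ℕ), |d2Kernel P.eps⁻¹ μ' μ (gpiece P a msq k j) x x'| ≤
      C₀ * ((P.eps ^ 3)⁻¹ * (((P.L : ℝ) ^ j)⁻¹ ^ 3 * Real.exp (-(δ₀ * (supDist x x' : ℝ) / (P.L : ℝ) ^ j)))) := by
    intro j
    refine (hmix j μ' μ x x').trans ?_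
    have hpre : P.spacing j ^ (-((P.d : ℕ) : ℝ)) = (P.eps ^ 3)⁻¹ * ((P.L : ℝ) ^ j)⁻¹ ^ 3 := by
      rw [hPd, rpow_neg_three (P.spacing_pos j), hsj, mul_pow, mul_inv, mul_comm]
      simp only [inv_pow]
    rw [hpre, mul_assoc, mul_assoc]
    exact mul_le_mul_of_nonneg_left (mul_le_mul_of_nonneg_left
      (mul_le_mul_of_nonneg_left (piece_exp_le P hδ₀.le j x x') (by positivity)) (by positivity)) hC₀.le
  have hse3 : P.spacing k ^ 3 * (P.eps ^ 3)⁻¹ = ((P.L : ℝ) ^ k) ^ 3 := by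
    rw [hsj, mul_pow, mul_assoc, mul_inv_cancel₀ (pow_ne_zero 3 hε.ne'), mul_one]
  set n : ℕ := supDist x x' with hn
  have hmax0 : 0 < max (1 : ℝ) (n : ℝ) := lt_max_of_lt_left one_pos
  have hsum : ∑ j ∈ range k, ((P.L : ℝ) ^ j)⁻¹ ^ 3 * Real.exp (-(δ₀ * n / (P.L : ℝ) ^ j)) ≤
      Cs3 * ((max (1 : ℝ) (n : ℝ))⁻¹ ^ 3 * Real.exp (-(δ₀ / 2 * ((n : ℝ) / (P.L : ℝ) ^ k)))) := by
    rw [hCs3, ← hPL']; exact scaleSum_le_max (one_lt_cast_L P) hδ₀ (by norm_num) k n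
  have hG := d2Kernel_G0xi_eq ha hmsq hd2 hk1 μ' μ x x'
  rw [hPd] at hG
  rw [hG, abs_mul, abs_of_pos (pow_pos hs 3)]
  have h1 : |∑ j ∈ range k, d2Kernel P.eps⁻¹ μ' μ (gpiece P a msq k j) x x'| ≤
      ∑ j ∈ range k, C₀ * ((P.eps ^ 3)⁻¹ * (((P.L : ℝ) ^ j)⁻¹ ^ 3 * Real.exp (-(δ₀ * (n : ℝ) / (P.L : ℝ) ^ j)))) :=
    (Finset.abs_sum_le_sum_abs _ _).trans (Finset.sum_le_sum fun j _ => hmix' j)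
  rw [← Finset.mul_sum, ← Finset.mul_sum] at h1
  calc P.spacing k ^ 3 * |∑ j ∈ range k, d2Kernel P.eps⁻¹ μ' μ (gpiece P a msq k j) x x'|
      ≤ P.spacing k ^ 3 * (C₀ * ((P.eps ^ 3)⁻¹ * ∑ j ∈ range k, ((P.L : ℝ) ^ j)⁻¹ ^ 3 *
          Real.exp (-(δ₀ * (n : ℝ) / (P.L : ℝ) ^ j)))) := mul_le_mul_of_nonneg_left h1 (pow_pos hs 3).le
    _ ≤ P.spacing k ^ 3 * (C₀ * ((P.eps ^ 3)⁻¹ * (Cs3 * ((max (1 : ℝ) (n : ℝ))⁻¹ ^ 3 *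
          Real.exp (-(δ₀ / 2 * ((n : ℝ) / (P.L : ℝ) ^ k))))))) := by gcongr
    _ = C₀ * Cs3 * (((P.eta k * max (1 : ℝ) (n : ℝ)) ^ 3)⁻¹ * Real.exp (-(δ₀ / 2 * (P.eta k * (n : ℝ))))) := by
        have hdiv : (n : ℝ) / (P.L : ℝ) ^ k = ((P.L : ℝ) ^ k)⁻¹ * (n : ℝ) := div_eq_inv_mul _ _
        rw [hηL, hdiv, mul_pow]
        simp only [inv_pow, mul_inv, inv_inv]
        calc P.spacing k ^ 3 * (C₀ * ((P.eps ^ 3)⁻¹ * (Cs3 * (((max (1 : ℝ) (n : ℝ)) ^ 3)⁻¹ *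
              Real.exp (-(δ₀ / 2 * (((P.L : ℝ) ^ k)⁻¹ * (n : ℝ))))))))
            = (P.spacing k ^ 3 * (P.eps ^ 3)⁻¹) * (C₀ * Cs3 * (((max (1 : ℝ) (n : ℝ)) ^ 3)⁻¹ *
              Real.exp (-(δ₀ / 2 * (((P.L : ℝ) ^ k)⁻¹ * (n : ℝ)))))) := by ring
          _ = _ := by rw [hse3]; ring
    _ ≤ C₀ * (Cs3 + 1) * (((P.eta k * max (1 : ℝ) (n : ℝ)) ^ 3)⁻¹ * Real.exp (-(δ₀ / 2 * (P.eta k * (n : ℝ))))) := by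
        have h0 : 0 ≤ ((P.eta k * max (1 : ℝ) (n : ℝ)) ^ 3)⁻¹ * Real.exp (-(δ₀ / 2 * (P.eta k * (n : ℝ)))) := by
          have := eta_pos P k; positivity
        refine mul_le_mul_of_nonneg_right ?_ h0
        exact mul_le_mul_of_nonneg_left (by linarith) hC₀.le

/-- **The printed bounds for the rescaled propagator WITH the column difference**, at all sites (`d = 3`): `∃ δ C > 0` uniform in
`P = (3,L,m,K)`, `1 ≤ k ≤ K` with `|G^ξ_k(0)| ≤ C·P₁`, `|∂^ξ_μG^ξ_k(0)|, |G^ξ_k(0)∂^{ξ*}_μ| ≤ C·P₂` and `|∂^ξ_{μ′}G^ξ_k(0)∂^{ξ*}_μ| ≤ C·P₃`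
(`P_p(y,y′) = (ξ·max(1,|y−y′|))^{−p}e^{−δξ|y−y′|}`) — `G0xi_bounds`, the symmetry `G0xi_symm`, `G0xi_mixed_bound`, rates merged.
[cite: Balaban1983Higgs3, (3.16) p.437, (3.26) p.441] -/
theorem G0xi_all_bounds (L : ℕ) (hL : Odd L ∧ 1 < L) {a : ℝ} (ha : 0 < a) {msq : ℝ} (hmsq : 0 ≤ msq) :
    ∃ δ C : ℝ, 0 < δ ∧ 0 < C ∧ ∀ (P : Params), P.d = 3 → P.L = L → ∀ k : ℕ, 1 ≤ k → k ≤ P.K →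
      (∀ y y' : Site P 0, |G0xi P a msq k y y'| ≤
          C * ((P.eta k * max (1 : ℝ) (supDist y y' : ℝ))⁻¹ * Real.exp (-(δ * (P.eta k * (supDist y y' : ℝ)))))) ∧
      (∀ (μ : Fin P.d) (y y' : Site P 0), |d1Kernel (P.eta k)⁻¹ μ (G0xi P a msq k) y y'| ≤
          C * (((P.eta k * max (1 : ℝ) (supDist y y' : ℝ)) ^ 2)⁻¹ * Real.exp (-(δ * (P.eta k * (supDist y y' : ℝ)))))) ∧
      (∀ (μ : Fin P.d) (y x' : Site P 0), |dAdjKernel (P.eta k)⁻¹ μ (G0xi P a msq k) y x'| ≤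
          C * (((P.eta k * max (1 : ℝ) (supDist y x' : ℝ)) ^ 2)⁻¹ * Real.exp (-(δ * (P.eta k * (supDist y x' : ℝ)))))) ∧
      (∀ (μ' μ : Fin P.d) (x x' : Site P 0), |d2Kernel (P.eta k)⁻¹ μ' μ (G0xi P a msq k) x x'| ≤
          C * (((P.eta k * max (1 : ℝ) (supDist x x' : ℝ)) ^ 3)⁻¹ * Real.exp (-(δ * (P.eta k * (supDist x x' : ℝ)))))) := by
  obtain ⟨δ₁, C₁, hδ₁, hC₁, H1⟩ := G0xi_bounds L hL ha hmsq
  obtain ⟨δ₂, C₂, hδ₂, hC₂, H2⟩ := G0xi_mixed_bound L hL ha hmsq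
  have hm : 0 < min δ₁ δ₂ := lt_min hδ₁ hδ₂
  refine ⟨min δ₁ δ₂, max C₁ C₂, hm, lt_max_of_lt_left hC₁, fun P hPd hPL k hk1 hkK => ?_⟩
  obtain ⟨hv, hr⟩ := H1 P hPd hPL k hk1 hkK
  have hmx := H2 P hPd hPL k hk1 hkK
  have hkm : k ≤ P.m + P.K := hkK.trans (Nat.le_add_left _ _)
  have hη : 0 < P.eta k := eta_pos P k
  -- weakening a bound `C·q·e^{−δt}` to `max C₁ C₂·q·e^{−min t}`
  have weak : ∀ {v C δ q : ℝ} (t : ℕ), C ≤ max C₁ C₂ → min δ₁ δ₂ ≤ δ → 0 ≤ q →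
      v ≤ C * (q * Real.exp (-(δ * (P.eta k * (t : ℝ))))) →
      v ≤ max C₁ C₂ * (q * Real.exp (-(min δ₁ δ₂ * (P.eta k * (t : ℝ))))) := by
    intro v C δ q t hC hδ hq h
    refine h.trans ?_
    have he : Real.exp (-(δ * (P.eta k * (t : ℝ)))) ≤ Real.exp (-(min δ₁ δ₂ * (P.eta k * (t : ℝ)))) :=
      Real.exp_le_exp.mpr (neg_le_neg (mul_le_mul_of_nonneg_right hδ (mul_nonneg hη.le (Nat.cast_nonneg t))))
    exact mul_le_mul hC (mul_le_mul_of_nonneg_left he hq) (by positivity) (le_trans hC₁.le (le_max_left _ _))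
  refine ⟨fun y y' => ?_, fun μ y y' => ?_, fun μ y x' => ?_, fun μ' μ x x' => ?_⟩
  · exact weak (supDist y y') (le_max_left _ _) (min_le_left _ _) (by positivity) (hv y y')
  · exact weak (supDist y y') (le_max_left _ _) (min_le_left _ _) (by positivity) (hr μ y y')
  · rw [dAdjKernel_eq_d1Kernel_of_symm _ μ _ (fun z z' => G0xi_symm ha hmsq (by omega) hk1 hkm z z') y x',
      supDist_comm y x']
    exact weak (supDist x' y) (le_max_left _ _) (min_le_left _ _) (by positivity) (hr μ x' y)
  · exact weak (supDist x x') (le_max_right _ _) (min_le_right _ _) (by positivity) (hmx μ' μ x x')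

end G0

/-! ## §2 The column difference of the torus free propagator -/

/-- **`|(C^ξ_T∂^{ξ*}_μ)(y,x′)| ≤ (3037500 + torusConst + 472501)·(ξ·max(1,|y−x′|))^{−2}e^{−½ξ|y−x′|}`** at all sites (`d = 3`, `0 < ξ ≤ 1`,
`ξN ≥ 1`): by the symmetry of `C^ξ_T` the column difference is the row difference of `abs_d1Kernel_CxiT_profile` at swapped arguments.
[cite: Balaban1983Higgs3, (3.16) p.437, (3.26) p.441] -/
theorem dAdjKernel_CxiT_profile {j : ℕ} (hd : P.d = 3) {ξ : ℝ} (hξ : 0 < ξ) (hξ1 : ξ ≤ 1)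
    (hN : 1 ≤ ξ * (P.sitesPerDir j : ℝ)) (μ : Fin P.d) (y x' : Site P j) :
    |dAdjKernel ξ⁻¹ μ (CxiT ξ) y x'| ≤ (3037500 + torusConst + 472501) *
      (((ξ * max (1 : ℝ) (supDist y x' : ℝ)) ^ 2)⁻¹ * Real.exp (-(1 / 2 * (ξ * (supDist y x' : ℝ))))) := by
  rw [dAdjKernel_eq_d1Kernel_of_symm _ μ _ (fun z z' => CxiT_symm ξ z z') y x', supDist_comm y x']
  exact abs_d1Kernel_CxiT_profile hd hξ hξ1 hN μ x' y

/-! ## §3 The middle operator `D = (1 − (L^kε)²m²)·1 − a_kP_k` preserves the kernel shapes -/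

section Dmid

/-- kernel: `Σ_{z′}D(z,z′)K(z′,y) = (1 − (L^kε)²m²)K(z,y) − a_kΣ_{z′}P_k(z,z′)K(z′,y)`. [cite: Balaban1983Higgs3, (3.16) p.437] -/
theorem Dmid_mul_apply (a msq : ℝ) (k : ℕ) (K : Kernel P 0) (z y : Site P 0) :
    ∑ z' : Site P 0, Dmid P a msq k z z' * K z' y =
      (1 - P.spacing k ^ 2 * msq) * K z y - B1.aSeq a P.L k * ∑ z' : Site P 0, (Qks P k * Qk P k) z z' * K z' y := by
  classical
  simp_rw [Dmid_apply, sub_mul, Finset.sum_sub_distrib, mul_assoc, ← Finset.mul_sum]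
  congr 1
  simp_rw [ite_mul, one_mul, zero_mul]
  rw [Finset.sum_ite_eq, if_pos (Finset.mem_univ _)]

/-- kernel: the scalar factors of `D`: `|1 − (L^kε)²m²| ≤ 1 + m²` and `0 ≤ a_k ≤ a` for `1 ≤ k ≤ K`. [cite: Balaban1983Higgs3, (3.16) p.437] -/
theorem Dmid_coeff_bounds {a msq : ℝ} (ha : 0 < a) (hmsq : 0 ≤ msq) {k : ℕ} (hk1 : 1 ≤ k) (hkK : k ≤ P.K) :
    |1 - P.spacing k ^ 2 * msq| ≤ 1 + msq ∧ 0 ≤ B1.aSeq a P.L k ∧ B1.aSeq a P.L k ≤ a := by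
  have hs1 : P.spacing k ≤ 1 := spacing_le_one P hkK
  have hs0 : 0 < P.spacing k := P.spacing_pos k
  have hL1 : (1 : ℝ) < (P.L : ℝ) := one_lt_cast_L P
  have hs2 : P.spacing k ^ 2 ≤ 1 := pow_le_one₀ hs0.le hs1
  have hsm : P.spacing k ^ 2 * msq ≤ msq := mul_le_of_le_one_left hmsq hs2
  have hsm0 : 0 ≤ P.spacing k ^ 2 * msq := mul_nonneg (pow_nonneg hs0.le 2) hmsq
  refine ⟨?_, (B1.aSeq_pos ha hL1 hk1).le, B1.aSeq_le ha hL1 k hk1⟩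
  rw [abs_le]; constructor <;> linarith

/-- **The middle operator on a 1-profile**: if `|K(z′,y)| ≤ b(ξ·max(1,|z′−y|))^{−1}e^{−βξ|z′−y|}` at all sites (`ξ = L^{−k}`, `d = 3`,
`1 ≤ k ≤ K`), then `|Σ_{z′}D(z,z′)K(z′,y)| ≤ ((1 + m²) + a·(4e^{4β}(1 + radialConst 3 β 1 1) + 2e^{2β}))·b·(ξ·max(1,|z−y|))^{−1}e^{−βξ|z−y|}`
(`smear_one_le` for `P_k`: `|P_k| ≤ ξ^d`, unit blocks, row sums `1`). [cite: Balaban1983Higgs3, (3.16) p.437] -/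
theorem abs_Dmid_smear_one_le {a msq : ℝ} (ha : 0 < a) (hmsq : 0 ≤ msq) (hPd : P.d = 3) {k : ℕ} (hk1 : 1 ≤ k) (hkK : k ≤ P.K)
    {β b : ℝ} (hβ : 0 < β) (hb : 0 ≤ b) (K : Kernel P 0)
    (hK : ∀ z' y : Site P 0, |K z' y| ≤
      b * ((P.eta k * max (1 : ℝ) (supDist z' y : ℝ))⁻¹ * Real.exp (-(β * (P.eta k * (supDist z' y : ℝ))))))
    (z y : Site P 0) :
    |∑ z' : Site P 0, Dmid P a msq k z z' * K z' y| ≤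
      ((1 + msq) + a * (4 * Real.exp (4 * β) * 1 * (1 + radialConst 3 β 1 1) + 2 * Real.exp (2 * β) * 1)) * b *
        ((P.eta k * max (1 : ℝ) (supDist z y : ℝ))⁻¹ * Real.exp (-(β * (P.eta k * (supDist z y : ℝ))))) := by
  have hkm : k ≤ P.m + P.K := hkK.trans (Nat.le_add_left _ _)
  have hη : 0 < P.eta k := eta_pos P k
  have hη1 : P.eta k ≤ 1 := eta_le_one P k
  obtain ⟨hc₁, hc₂, hc₂'⟩ := Dmid_coeff_bounds (P := P) ha hmsq hk1 hkK
  have hE : ∀ z z' : Site P 0, |(Qks P k * Qk P k) z z'| ≤ 1 * P.eta k ^ P.d := fun z z' => by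
    rw [one_mul]; exact Pk_abs_le hkm z z'
  have hEs : ∀ z z' : Site P 0, (Qks P k * Qk P k) z z' ≠ 0 → P.eta k * (supDist z z' : ℝ) ≤ 2 :=
    fun z z' h => eta_supDist_le_two_of_Pk_ne_zero hkm h
  have hE1 : ∀ z : Site P 0, ∑ z' : Site P 0, |(Qks P k * Qk P k) z z'| ≤ 1 := fun z => (sum_abs_Pk_row hkm z).le
  have hsm := smear_one_le hPd hη hη1 hβ hb zero_le_one zero_le_one (fun z z' => (Qks P k * Qk P k) z z') K hE hEs hE1 hK z y
  set prof : ℝ := (P.eta k * max (1 : ℝ) (supDist z y : ℝ))⁻¹ * Real.exp (-(β * (P.eta k * (supDist z y : ℝ)))) with hprof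
  have hprof0 : 0 ≤ prof := by positivity
  set S : ℝ := 4 * Real.exp (4 * β) * 1 * (1 + radialConst 3 β 1 1) + 2 * Real.exp (2 * β) * 1 with hS
  have hS0 : 0 ≤ S := by have := radialConst_nonneg 3 hβ zero_le_one 1; positivity
  rw [Dmid_mul_apply]
  have hT1 : |(1 - P.spacing k ^ 2 * msq) * K z y| ≤ (1 + msq) * (b * prof) := by
    rw [abs_mul]; exact mul_le_mul hc₁ (hK z y) (abs_nonneg _) (by positivity)
  have hT2 : |B1.aSeq a P.L k * ∑ z' : Site P 0, (Qks P k * Qk P k) z z' * K z' y| ≤ a * (b * S * prof) := by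
    rw [abs_mul, abs_of_nonneg hc₂]
    refine mul_le_mul hc₂' ?_ (abs_nonneg _) ha.le
    refine (Finset.abs_sum_le_sum_abs _ _).trans ?_
    simp only [abs_mul]
    exact hsm
  calc |(1 - P.spacing k ^ 2 * msq) * K z y - B1.aSeq a P.L k * ∑ z' : Site P 0, (Qks P k * Qk P k) z z' * K z' y|
      ≤ (1 + msq) * (b * prof) + a * (b * S * prof) := (abs_sub _ _).trans (add_le_add hT1 hT2)
    _ = ((1 + msq) + a * S) * b * prof := by ring

/-- **The middle operator on a 2-profile**: if `|K(z′,y)| ≤ b(ξ·max(1,|z′−y|))^{−2}e^{−βξ|z′−y|}` at all sites, then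
`|Σ_{z′}D(z,z′)K(z′,y)| ≤ ((1 + m²) + a·(16e^{4β}(1 + radialConst 3 β 1 0) + 4e^{2β}))·b·(ξ·max(1,|z−y|))^{−2}e^{−βξ|z−y|}` (`smear_two_le`).
[cite: Balaban1983Higgs3, (3.16) p.437] -/
theorem abs_Dmid_smear_two_le {a msq : ℝ} (ha : 0 < a) (hmsq : 0 ≤ msq) (hPd : P.d = 3) {k : ℕ} (hk1 : 1 ≤ k) (hkK : k ≤ P.K)
    {β b : ℝ} (hβ : 0 < β) (hb : 0 ≤ b) (K : Kernel P 0)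
    (hK : ∀ z' y : Site P 0, |K z' y| ≤
      b * (((P.eta k * max (1 : ℝ) (supDist z' y : ℝ)) ^ 2)⁻¹ * Real.exp (-(β * (P.eta k * (supDist z' y : ℝ))))))
    (z y : Site P 0) :
    |∑ z' : Site P 0, Dmid P a msq k z z' * K z' y| ≤
      ((1 + msq) + a * (16 * Real.exp (4 * β) * 1 * (1 + radialConst 3 β 1 0) + 4 * Real.exp (2 * β) * 1)) * b *
        (((P.eta k * max (1 : ℝ) (supDist z y : ℝ)) ^ 2)⁻¹ * Real.exp (-(β * (P.eta k * (supDist z y : ℝ))))) := by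
  have hkm : k ≤ P.m + P.K := hkK.trans (Nat.le_add_left _ _)
  have hη : 0 < P.eta k := eta_pos P k
  have hη1 : P.eta k ≤ 1 := eta_le_one P k
  obtain ⟨hc₁, hc₂, hc₂'⟩ := Dmid_coeff_bounds (P := P) ha hmsq hk1 hkK
  have hE : ∀ z z' : Site P 0, |(Qks P k * Qk P k) z z'| ≤ 1 * P.eta k ^ P.d := fun z z' => by
    rw [one_mul]; exact Pk_abs_le hkm z z'
  have hEs : ∀ z z' : Site P 0, (Qks P k * Qk P k) z z' ≠ 0 → P.eta k * (supDist z z' : ℝ) ≤ 2 :=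
    fun z z' h => eta_supDist_le_two_of_Pk_ne_zero hkm h
  have hE1 : ∀ z : Site P 0, ∑ z' : Site P 0, |(Qks P k * Qk P k) z z'| ≤ 1 := fun z => (sum_abs_Pk_row hkm z).le
  have hsm := smear_two_le hPd hη hη1 hβ hb zero_le_one zero_le_one (fun z z' => (Qks P k * Qk P k) z z') K hE hEs hE1 hK z y
  set prof : ℝ := ((P.eta k * max (1 : ℝ) (supDist z y : ℝ)) ^ 2)⁻¹ * Real.exp (-(β * (P.eta k * (supDist z y : ℝ))))
    with hprof
  have hprof0 : 0 ≤ prof := by positivity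
  set S : ℝ := 16 * Real.exp (4 * β) * 1 * (1 + radialConst 3 β 1 0) + 4 * Real.exp (2 * β) * 1 with hS
  have hS0 : 0 ≤ S := by have := radialConst_nonneg 3 hβ zero_le_one 0; positivity
  rw [Dmid_mul_apply]
  have hT1 : |(1 - P.spacing k ^ 2 * msq) * K z y| ≤ (1 + msq) * (b * prof) := by
    rw [abs_mul]; exact mul_le_mul hc₁ (hK z y) (abs_nonneg _) (by positivity)
  have hT2 : |B1.aSeq a P.L k * ∑ z' : Site P 0, (Qks P k * Qk P k) z z' * K z' y| ≤ a * (b * S * prof) := by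
    rw [abs_mul, abs_of_nonneg hc₂]
    refine mul_le_mul hc₂' ?_ (abs_nonneg _) ha.le
    refine (Finset.abs_sum_le_sum_abs _ _).trans ?_
    simp only [abs_mul]
    exact hsm
  calc |(1 - P.spacing k ^ 2 * msq) * K z y - B1.aSeq a P.L k * ∑ z' : Site P 0, (Qks P k * Qk P k) z z' * K z' y|
      ≤ (1 + msq) * (b * prof) + a * (b * S * prof) := (abs_sub _ _).trans (add_le_add hT1 hT2)
    _ = ((1 + msq) + a * S) * b * prof := by ring

end Dmid

end

end Literature.MathematicalPhysics.QuantumFieldTheory.Balaban1983to89.B3ZeroTorusKernelProfiles
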